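import Summits.Langlands.Langlands.Theorems.IrreducibilityBySelfDualityRegularTwistFromHalfIntegralShadow
import Summits.Langlands.Langlands.Theorems.IrreducibilityBySelfDualityRegularTwistCMDihedralVacuity
import Summits.Langlands.Langlands.Theorems.IrreducibilityBySelfDualityRegularTwistCMCentralCharacterDatum
import Summits.Langlands.Langlands.Theorems.IrreducibilityBySelfDualityHalfIntegralTwistCM
import Literature.NumberTheory.Automorphic.ClozelPurityProofs
import Literature.NumberTheory.Automorphic.StrongMultiplicityOneRepDataAE
import HarnessLib

/-!
# Crux `RegularTwistCM` (route `IrreducibilityBySelfDuality`, item stmt-Langlands-14069) — the crux body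
# modulo its three archimedean named facts (Theses-free, cycle-free)

The crux: for `K` CM, `π` regular algebraic cuspidal on `GL₃(𝔸_K)`, `σ₀` cuspidal on `GL₂(𝔸_K)` and a
`GL(1)` datum `ν` with `t_{π,v} = d_v · Ad(t_{σ₀,v})` a.e., SOME `GL(1)`-twist `σ = σ₀ ⊗ χ` is regular
algebraic (`Summit.Langlands.Langlands.Theses.IrreducibilityBySelfDuality.RegularTwistCM`).

CYCLE HAZARD. When the item closes the gate appends `theorem RegularTwistCM_holds` to the route file with
`import <closing module>`, so a closing module must NOT import
`Summits.Langlands.Langlands.Theses.IrreducibilityBySelfDuality` — and the landed composition of the glue item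
stmt-Langlands-14726 (`IrreducibilityBySelfDualityRegularTwistFromHalfIntegral.lean`,
`RegularTwistFromHalfIntegral_of_inputs`; and its sharpening `…SMO.lean`) does. This file re-elaborates that
composition with the STRUCTURAL conclusion (the crux body inlined verbatim, so that its type is the route
decl by `δ`-unfolding) from Theses-free modules only, with the lever `HalfIntegralTwistCM` (route item
stmt-Landlands-14036) supplied by its landed proof
`HalfIntegralTwistCM.TwoPrimaryChevalleyCore.HalfIntegralTwistCM_proof`:

* `regularTwistCM_of_inputs` — the crux body from the shadow and the descent infinity type (everything
  else proved: `stub_dihedralVacuity`, `stub_centralCharacterDatum`, `stub_twistRealisation`, Clozel purity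
  `purity_of_isCAlgebraic`, `HalfIntegralTwistCM_proof`);
* `regularTwistCM_of_facts` — **the crux body modulo the THREE named facts**
  `GelbartJacquet_adjoint_lift_archimedean` (Gelbart–Jacquet 1978, Thm. (9.3) + Prop. (3.2)),
  `strong_multiplicity_one_gl_sphericalLevel 3 K` for all `K` (Jacquet–Shalika 1981 II, Thm. 4.4) and
  `exists_hasInfinityType` for cuspidal `GL₂` data (Clozel 1990, §3.3: the integral pairing at a complex
  place); the adjoint archimedean shadow (r3 stub 1a) is derived inside the proof from the first two, as
  in `…RegularTwistFromHalfIntegralSMO.lean` (`hasArchParameter_eq_of_isNearlyEquivalent_of_smo`).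
  CONDITIONAL result: the item closes the day these are discharged (lead skeleton r4 of
  `Cruxes/RegularTwistCM/Lines/petersson-hermitian-purity.lean` has exactly these three as its stubs).
-/

set_option linter.dupNamespace false -- project-wide option (lakefile weak.linter.dupNamespace); `Summit.Langlands.Langlands` is the mandated namespace

noncomputable section

open scoped ComplexConjugate Classical
open NumberField Filter
open Literature.NumberTheory.Automorphic

namespace Summit.Langlands.Langlands.Theorems.RegularTwistCM

open RegularTwistFromHalfIntegral

/-! ## The crux body from the shadow and the descent infinity type -/

/-- **The crux body (verbatim) from the adjoint archimedean shadow and the descent infinity type**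
(r3's `RegularTwistCM_of_stubs` with stubs 1b/3/5 the landed theorems, the lever the landed
`HalfIntegralTwistCM_proof`, and the parity from Clozel purity; the proof of
`RegularTwistFromHalfIntegral_of_inputs`, re-elaborated Theses-free with the structural conclusion).
For `K` CM, `π` regular algebraic cuspidal on `GL₃`, `σ₀` cuspidal on `GL₂`, `ν` on `GL₁` with
`t_π = d · Ad(t_{σ₀})` a.e.: `σ₀` is non-dihedral (`stub_dihedralVacuity`); write its parameter as paired
exponents `{s₁ ι, s₂ ι}` (descent infinity type `hD`); the shadow `hA` gives
`P_π(ι) = {s₁ - s₂ + q, q, s₂ - s₁ + q}`, so `s₁ - s₂, q ∈ ℤ` (C-algebraicity of `π`), `s₁ ≠ s₂`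
(regularity) and `(s₁ - s₂)(ι) + (s₁ - s₂)(ῑ)` even (purity of `π`); the central character of `σ₀` is a
`GL(1)` datum with parameter `{s₁ + s₂}` (`stub_centralCharacterDatum`); `HalfIntegralTwistCM_proof`
returns `χ` with parameter `{p ι}`, `p + s₁ ∈ ½ + ℤ`; and `σ = σ₀ ⊗ χ` (`stub_twistRealisation`) carries
the explicit regular algebraic infinity type `{(s₁ + p)(ι), (s₁ + p)(ῑ)), ((s₂ + p)(ι), (s₂ + p)(ῑ))}`.
[cite: Clozel1990, Lemme 4.9] [cite: GelbartJacquet1978, Thm. (9.3)] -/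
theorem regularTwistCM_of_inputs
    (hA : ∀ (K : Type) [Field K] [NumberField K]
      (h1 : isCompact_glFiniteIntegralLevel 1 K) (hcpt₂ : isCompact_glFiniteIntegralLevel 2 K)
      (hcpt : isCompact_glFiniteIntegralLevel 3 K)
      (π : CuspidalAutomorphicRepData 3 K hcpt) (σ₀ : CuspidalAutomorphicRepData 2 K hcpt₂)
      (ν : CuspidalAutomorphicRepData 1 K h1),
      (∀ (L : Type) [Field L] [NumberField L] [Algebra K L], Module.finrank K L = 2 →
        ¬ IsQuadraticSelfTwistAE L σ₀.1) →
      (∀ᶠ v in cofinite, ∀ α β : Multiset ℂ, π.1.HasSatakeParamAt v α →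
        σ₀.1.HasSatakeParamAt v β → ∃ d : ℂ, ν.1.HasSatakeParamAt v {d} ∧
          α = (((β ×ˢ β).map (fun r : ℂ × ℂ => r.1 * r.2⁻¹)).erase 1).map (fun e => d * e)) →
      ∀ (χπ χσ χν : (K →+* ℂ) → Multiset ℂ),
        π.1.HasArchParameter χπ → σ₀.1.HasArchParameter χσ → ν.1.HasArchParameter χν →
        ∀ (ι : K →+* ℂ) (x y q : ℂ), χσ ι = {x, y} → χν ι = {q} →
          χπ ι = {x - y + q, q, y - x + q})
    (hD : ∀ (K : Type) [Field K] [NumberField K] (hcpt₂ : isCompact_glFiniteIntegralLevel 2 K)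
      (σ₀ : CuspidalAutomorphicRepData 2 K hcpt₂), σ₀.1.exists_hasInfinityType) :
    ∀ (K : Type) [Field K] [NumberField K], NumberField.IsCMField K →
      ∀ (h1 : Literature.NumberTheory.Automorphic.isCompact_glFiniteIntegralLevel 1 K)
        (hcpt₂ : Literature.NumberTheory.Automorphic.isCompact_glFiniteIntegralLevel 2 K)
        (hcpt : Literature.NumberTheory.Automorphic.isCompact_glFiniteIntegralLevel 3 K)
        (π : Literature.NumberTheory.Automorphic.CuspidalAutomorphicRepData 3 K hcpt)
        (σ₀ : Literature.NumberTheory.Automorphic.CuspidalAutomorphicRepData 2 K hcpt₂)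
        (ν : Literature.NumberTheory.Automorphic.CuspidalAutomorphicRepData 1 K h1),
        π.1.IsRegularAlgebraic →
        (∀ᶠ v in cofinite, ∀ α β : Multiset ℂ, π.1.HasSatakeParamAt v α →
          σ₀.1.HasSatakeParamAt v β → ∃ d : ℂ, ν.1.HasSatakeParamAt v {d} ∧
            α = (((β ×ˢ β).map (fun p : ℂ × ℂ => p.1 * p.2⁻¹)).erase 1).map (fun c => d * c)) →
        ∃ (σ : Literature.NumberTheory.Automorphic.CuspidalAutomorphicRepData 2 K hcpt₂)
          (χ : Literature.NumberTheory.Automorphic.CuspidalAutomorphicRepData 1 K h1),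
          σ.1.IsRegularAlgebraic ∧ ∀ᶠ v in cofinite, ∀ β : Multiset ℂ, σ₀.1.HasSatakeParamAt v β →
            ∃ c : ℂ, χ.1.HasSatakeParamAt v {c} ∧ σ.1.HasSatakeParamAt v (β.map (fun b => c * b)) := by
  intro K _ _ hCM h1 hcpt₂ hcpt π σ₀ ν hRA hAd
  classical
  haveI : NeZero (2 : ℕ) := ⟨by norm_num⟩
  -- the lever, a theorem of the tree (route item stmt-Langlands-14036, body verbatim)
  have hH := HalfIntegralTwistCM.TwoPrimaryChevalleyCore.HalfIntegralTwistCM_proof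
  -- Step 0 (landed stub 1b of r3): `σ₀` is not an a.e. quadratic self-twist
  have hnd : ∀ (L : Type) [Field L] [NumberField L] [Algebra K L], Module.finrank K L = 2 →
      ¬ IsQuadraticSelfTwistAE L σ₀.1 :=
    fun L _ _ _ hL hst => RegularTwistCM.stub_dihedralVacuity K h1 hcpt₂ hcpt π σ₀ ν L hL hst hAd
  -- Step 1 (descent infinity type `hD`): paired exponent functions of `σ₀`
  obtain ⟨T₀, hT₀⟩ := hD K hcpt₂ σ₀
  obtain ⟨s₁, s₂, hσ, hpair⟩ := exists_paired_exponents_of_hasInfinityType hT₀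
  -- Step 2 (tree): the archimedean parameter `{q ι}` of the `GL(1)` datum `ν`
  obtain ⟨χν, hχν⟩ := ν.1.exists_hasArchParameter_glOne
  have hq : ∃ q : (K →+* ℂ) → ℂ, ∀ ι, χν ι = {q ι} := by
    have h1c : ∀ ι, ∃ a, χν ι = {a} := fun ι =>
      Multiset.card_eq_one.mp (AutomorphicRepData.card_eq_of_hasArchParameter hχν ι)
    choose q hq using h1c
    exact ⟨q, hq⟩
  obtain ⟨q, hq⟩ := hq
  -- Step 3: the regular algebraic infinity type of `π`
  obtain ⟨T, ⟨hTwf, hTarch⟩, hTC, hTreg⟩ := hRA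
  -- Step 4 (shadow `hA`): the adjoint shadow at every embedding
  have hsh : ∀ ι, (T ι).map ArchWeight.a = {s₁ ι - s₂ ι + q ι, q ι, s₂ ι - s₁ ι + q ι} :=
    fun ι => hA K h1 hcpt₂ hcpt π σ₀ ν hnd hAd _ _ _ hTarch hσ hχν ι (s₁ ι) (s₂ ι) (q ι) rfl (hq ι)
  -- Step 5: integrality from C-algebraicity of `π` (`n = 3`: exponents in `1 + ℤ = ℤ`)
  have hint : ∀ ι, ∀ z ∈ (T ι).map ArchWeight.a, ∃ k : ℤ, z = k := by
    intro ι z hz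
    obtain ⟨w, hw, rfl⟩ := Multiset.mem_map.mp hz
    obtain ⟨k, l, hk, -⟩ := hTC ι w hw
    exact ⟨k + 1, by rw [hk]; push_cast; ring⟩
  have hqZ : ∀ ι, ∃ k : ℤ, q ι = k := fun ι => hint ι (q ι) (by rw [hsh ι]; simp)
  have haZ : ∀ ι, ∃ k : ℤ, s₁ ι - s₂ ι = k := by
    intro ι
    obtain ⟨k₁, hk₁⟩ := hint ι (s₁ ι - s₂ ι + q ι) (by rw [hsh ι]; simp)
    obtain ⟨k₂, hk₂⟩ := hqZ ι
    exact ⟨k₁ - k₂, by push_cast; linear_combination hk₁ - hk₂⟩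
  -- Step 6: regularity of `π` forces `s₁ ι ≠ s₂ ι`
  have ha0 : ∀ ι, s₁ ι - s₂ ι ≠ 0 := by
    intro ι h0
    have hnd := hTreg ι
    rw [hsh ι, Multiset.insert_eq_cons, Multiset.nodup_cons] at hnd
    apply hnd.1
    rw [h0, zero_add]
    simp
  -- Step 7 (Clozel purity, proved in tree): `{a at ῑ} = {w - a : a at ι}` for the C-algebraic `π`, and
  -- the parity of `(s₁-s₂)(ι) + (s₁-s₂)(ῑ)` from the adjoint shape
  obtain ⟨w, hw⟩ := π.purity_of_isCAlgebraic ⟨hTwf, hTarch⟩ hTC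
  have hpar : ∀ ι, ∃ m : ℤ, (s₁ ι - s₂ ι) +
      (s₁ (ComplexEmbedding.conjugate ι) - s₂ (ComplexEmbedding.conjugate ι)) = 2 * m := by
    intro ι
    have h := hw ι
    rw [hsh ι, hsh (ComplexEmbedding.conjugate ι)] at h
    exact parity_of_purity3 (haZ ι) (ha0 (ComplexEmbedding.conjugate ι)) h
  -- Step 8 (landed stub 3 of r3): the central character of `σ₀` as a `GL(1)` datum with parameter
  -- `{s₁ ι + s₂ ι}`
  obtain ⟨ω, hω⟩ := RegularTwistCM.stub_centralCharacterDatum 2 K h1 hcpt₂ σ₀ _ hσ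
  have hω' : ω.1.HasArchParameter (fun ι => {s₁ ι + s₂ ι}) := by
    have e : (fun ι : K →+* ℂ => ({(({s₁ ι, s₂ ι} : Multiset ℂ)).sum} : Multiset ℂ)) =
        fun ι => {s₁ ι + s₂ ι} := by
      funext ι
      simp
    rw [← e]
    exact hω
  -- Step 9 (the lever, proved): the half-integral twisting datum `χ`
  obtain ⟨χ, p, hχ, hp⟩ := hH K hCM h1 s₁ s₂ haZ (fun ι => (hpair ι).1) hpar ⟨ω, hω'⟩
  -- Step 10 (landed stub 5 of r3): realise `σ = σ₀ ⊗ χ`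
  obtain ⟨σ, hσarch, hσsat⟩ := RegularTwistCM.stub_twistRealisation 2 K h1 hcpt₂ σ₀ χ _ p hσ hχ
  refine ⟨σ, χ, ?_, hσsat⟩
  -- Step 11: the regular algebraic certificate of `σ` (explicit well-formed infinity type)
  choose mp hmp using hp
  choose ma hma using haZ
  have hw₁ : ∀ ι, ∃ m : ℤ, (s₁ ι + p ι) -
      (s₁ (ComplexEmbedding.conjugate ι) + p (ComplexEmbedding.conjugate ι)) = m := fun ι =>
    ⟨mp ι - mp (ComplexEmbedding.conjugate ι), by
      push_cast; linear_combination hmp ι - hmp (ComplexEmbedding.conjugate ι)⟩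
  have hw₂ : ∀ ι, ∃ m : ℤ, (s₂ ι + p ι) -
      (s₂ (ComplexEmbedding.conjugate ι) + p (ComplexEmbedding.conjugate ι)) = m := fun ι =>
    ⟨mp ι - mp (ComplexEmbedding.conjugate ι) - ma ι + ma (ComplexEmbedding.conjugate ι), by
      push_cast
      linear_combination hmp ι - hmp (ComplexEmbedding.conjugate ι) - hma ι +
        hma (ComplexEmbedding.conjugate ι)⟩
  let Tσ : InfinityType K 2 := fun ι =>
    {⟨s₁ ι + p ι, s₁ (ComplexEmbedding.conjugate ι) + p (ComplexEmbedding.conjugate ι), hw₁ ι⟩,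
     ⟨s₂ ι + p ι, s₂ (ComplexEmbedding.conjugate ι) + p (ComplexEmbedding.conjugate ι), hw₂ ι⟩}
  have hTa : ∀ ι, (Tσ ι).map ArchWeight.a = {s₁ ι + p ι, s₂ ι + p ι} := fun ι => by simp [Tσ]
  refine ⟨Tσ, ⟨⟨fun ι => by simp [Tσ], fun ι => ?_⟩, ?_⟩, fun ι w hw => ?_, fun ι => ?_⟩
  · -- conj-swap compatibility
    have e : ComplexEmbedding.conjugate (ComplexEmbedding.conjugate ι) = ι := star_star ι
    simp only [Tσ, Multiset.insert_eq_cons, Multiset.map_cons, Multiset.map_singleton]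
    congr 1
    · ext <;> simp [ArchWeight.swap, e]
    · congr 1
      ext <;> simp [ArchWeight.swap, e]
  · -- the archimedean parameter of `σ`
    have e : (fun ι : K →+* ℂ => (Tσ ι).map ArchWeight.a) =
        fun ι => (({s₁ ι, s₂ ι} : Multiset ℂ)).map (· + p ι) := by
      funext ι
      rw [hTa ι]
      simp
    rw [e]
    exact hσarch
  · -- C-algebraic: all exponents in `1/2 + ℤ`
    simp only [Tσ, Multiset.insert_eq_cons, Multiset.mem_cons, Multiset.mem_singleton] at hw
    rcases hw with rfl | rfl
    · refine ⟨mp ι, mp (ComplexEmbedding.conjugate ι), ?_, ?_⟩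
      · show s₁ ι + p ι = _
        push_cast
        linear_combination hmp ι
      · show s₁ (ComplexEmbedding.conjugate ι) + p (ComplexEmbedding.conjugate ι) = _
        push_cast
        linear_combination hmp (ComplexEmbedding.conjugate ι)
    · refine ⟨mp ι - ma ι, mp (ComplexEmbedding.conjugate ι) - ma (ComplexEmbedding.conjugate ι), ?_, ?_⟩
      · show s₂ ι + p ι = _
        push_cast
        linear_combination hmp ι - hma ι
      · show s₂ (ComplexEmbedding.conjugate ι) + p (ComplexEmbedding.conjugate ι) = _
        push_cast
        linear_combination hmp (ComplexEmbedding.conjugate ι) - hma (ComplexEmbedding.conjugate ι)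
  · -- regular
    rw [hTa ι, Multiset.insert_eq_cons, Multiset.nodup_cons]
    refine ⟨?_, Multiset.nodup_singleton _⟩
    rw [Multiset.mem_singleton]
    intro h
    exact ha0 ι (by linear_combination h)

/-! ## The crux body modulo the three named facts -/

/-- **`RegularTwistCM` modulo its three archimedean named facts** (CONDITIONAL result; structural
statement: the body of `Summit.Langlands.Langlands.Theses.IrreducibilityBySelfDuality.RegularTwistCM`
verbatim). For `K` CM, `π` regular algebraic cuspidal on `GL₃(𝔸_K)`, `σ₀` cuspidal on `GL₂(𝔸_K)`, `ν` a
`GL(1)` datum with `t_π = d · Ad(t_{σ₀})` a.e., some `GL(1)`-twist of `σ₀` is regular algebraic — granted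
Gelbart–Jacquet's adjoint lift with its archimedean clause (`GelbartJacquet_adjoint_lift_archimedean`),
strong multiplicity one for `GL₃` (`strong_multiplicity_one_gl_sphericalLevel 3 K`, all `K`) and the
existence of an infinity type for cuspidal `GL₂` data (`exists_hasInfinityType`, the integral pairing).
[cite: GelbartJacquet1978, Thm. (9.3), Prop. (3.2)] [cite: JacquetShalikaAJM1981II, Thm. 4.4]
[cite: Clozel1990, §3.3 and Lemme 4.9] -/
theorem regularTwistCM_of_facts :
    Literature.NumberTheory.Automorphic.GelbartJacquet_adjoint_lift_archimedean →
    (∀ (K : Type) [Field K] [NumberField K],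
      Literature.NumberTheory.Automorphic.strong_multiplicity_one_gl_sphericalLevel 3 K) →
    (∀ (K : Type) [Field K] [NumberField K]
      (hcpt₂ : Literature.NumberTheory.Automorphic.isCompact_glFiniteIntegralLevel 2 K)
      (σ₀ : Literature.NumberTheory.Automorphic.CuspidalAutomorphicRepData 2 K hcpt₂),
      σ₀.1.exists_hasInfinityType) →
    ∀ (K : Type) [Field K] [NumberField K], NumberField.IsCMField K →
      ∀ (h1 : Literature.NumberTheory.Automorphic.isCompact_glFiniteIntegralLevel 1 K)
        (hcpt₂ : Literature.NumberTheory.Automorphic.isCompact_glFiniteIntegralLevel 2 K)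
        (hcpt : Literature.NumberTheory.Automorphic.isCompact_glFiniteIntegralLevel 3 K)
        (π : Literature.NumberTheory.Automorphic.CuspidalAutomorphicRepData 3 K hcpt)
        (σ₀ : Literature.NumberTheory.Automorphic.CuspidalAutomorphicRepData 2 K hcpt₂)
        (ν : Literature.NumberTheory.Automorphic.CuspidalAutomorphicRepData 1 K h1),
        π.1.IsRegularAlgebraic →
        (∀ᶠ v in cofinite, ∀ α β : Multiset ℂ, π.1.HasSatakeParamAt v α →
          σ₀.1.HasSatakeParamAt v β → ∃ d : ℂ, ν.1.HasSatakeParamAt v {d} ∧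
            α = (((β ×ˢ β).map (fun p : ℂ × ℂ => p.1 * p.2⁻¹)).erase 1).map (fun c => d * c)) →
        ∃ (σ : Literature.NumberTheory.Automorphic.CuspidalAutomorphicRepData 2 K hcpt₂)
          (χ : Literature.NumberTheory.Automorphic.CuspidalAutomorphicRepData 1 K h1),
          σ.1.IsRegularAlgebraic ∧ ∀ᶠ v in cofinite, ∀ β : Multiset ℂ, σ₀.1.HasSatakeParamAt v β →
            ∃ c : ℂ, χ.1.HasSatakeParamAt v {c} ∧ σ.1.HasSatakeParamAt v (β.map (fun b => c * b)) := by
  intro hGJ hsmo hIT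
  refine regularTwistCM_of_inputs ?_ hIT
  -- the adjoint archimedean shadow for non-dihedral `σ₀` (r3 stub 1a), from `hGJ` and `hsmo`: the
  -- Gelbart–Jacquet lift `P` of `σ₀`, its twist `P' = P ⊗ ν` (`stub_twistRealisation`), `π ≈ P'` nearly
  -- equivalent (Satake uniqueness for `ν`), hence equal archimedean parameters
  -- (`hasArchParameter_eq_of_isNearlyEquivalent_of_smo`), read off at `ι` (`adjointShape_eq`)
  intro K _ _ h1 hcpt₂ hcpt π σ₀ ν hnd hAd χπ χσ χν hπ hσ hν ι x y q hxy hq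
  classical
  haveI : NeZero (3 : ℕ) := ⟨by norm_num⟩
  -- the parameter of `ν` is a family of singletons `{p σ}`
  have h1c : ∀ σ : K →+* ℂ, ∃ a : ℂ, χν σ = {a} := fun σ =>
    Multiset.card_eq_one.mp (AutomorphicRepData.card_eq_of_hasArchParameter hν σ)
  choose p hp using h1c
  have hνp : ν.1.HasArchParameter (fun σ => {p σ}) := by
    have e : χν = fun σ => {p σ} := funext hp
    rw [← e]
    exact hν
  -- the Gelbart–Jacquet lift `P` of `σ₀` with its archimedean clause (stub 1)
  obtain ⟨P, hPsat, hParch⟩ := hGJ K hcpt₂ hcpt σ₀ hnd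
  have hPχ : P.1.HasArchParameter (fun σ => (((χσ σ) ×ˢ (χσ σ)).map fun r => r.1 - r.2).erase 0) :=
    hParch χσ hσ
  -- the twist `P' = P ⊗ ν` (landed stub 5 of r3)
  obtain ⟨P', hP'arch, hP'sat⟩ :=
    RegularTwistCM.stub_twistRealisation 3 K h1 hcpt P ν _ p hPχ hνp
  -- `π` and `P'` are nearly equivalent
  have hne : π.1.IsNearlyEquivalent P'.1 := by
    have hcπ : ∀ᶠ v in cofinite, π.1.IsUnramifiedAt v :=
      AutomorphicRepData.hasSatakeParamAt_cofinite_holds π.1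
    have hcσ : ∀ᶠ v in cofinite, σ₀.1.IsUnramifiedAt v :=
      AutomorphicRepData.hasSatakeParamAt_cofinite_holds σ₀.1
    filter_upwards [hAd, hPsat, hP'sat, hcπ, hcσ] with v hv hPv hP'v hπv hσv
    obtain ⟨α, hα⟩ := hπv
    obtain ⟨β, hβ⟩ := hσv
    obtain ⟨d, hd, hαeq⟩ := hv α β hα hβ
    obtain ⟨c, hc, hP'c⟩ := hP'v (adParams β) (hPv β hβ)
    have hcd : c = d :=
      Multiset.singleton_inj.mp (AutomorphicRepData.hasSatakeParamAt_unique_holds ν.1 hc hd)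
    have had : adParams β = ((β ×ˢ β).map (fun r : ℂ × ℂ => r.1 * r.2⁻¹)).erase 1 := rfl
    refine ⟨α, hα, ?_⟩
    rw [hαeq, ← had, ← hcd]
    exact hP'c
  -- strong multiplicity one with the archimedean components (tree, modulo `hsmo` alone)
  obtain ⟨μm, hμm⟩ := AdelicGroupData.exists_isAutomorphicMeasure_gl_holds 3 K
  haveI := hμm
  have heq := CuspidalAutomorphicRepData.hasArchParameter_eq_of_isNearlyEquivalent_of_smo
    (μm := μm) (hsmo K) π P' hne hπ hP'arch
  -- read off at `ι`
  have hpq : p ι = q := by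
    have h := hp ι
    rw [hq] at h
    exact (Multiset.singleton_inj.mp h).symm
  have hι : χπ ι = ((((χσ ι) ×ˢ (χσ ι)).map fun r => r.1 - r.2).erase 0).map (· + p ι) :=
    congr_fun heq ι
  rw [hι, hxy, hpq]
  exact (RegularTwistCM.Negative.adjointShape_eq x y q).symm

end Summit.Langlands.Langlands.Theorems.RegularTwistCM

end
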